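import Summits.KontsevichZagierPeriods.KontsevichZagierPeriods.Theses.TorsionLogs
import Summits.KontsevichZagierPeriods.KontsevichZagierPeriods.Theorems.TorsionLogsNeronTorsionSector
import Summits.KontsevichZagierPeriods.KontsevichZagierPeriods.Theorems.TorsionLogsTorsionSectorCompleteReductions
import Literature.NumberTheory.Transcendental.KZKernelConjectureForms

/-!
# Line `NeronTorsionCoset` — crux `TorsionLogs.TorsionSectorComplete` (stmt-KontsevichZagierPeriods-14212)

Forward generator G1 (next rung), base `fwd2-rung-KontsevichZagierPeriods-01`, generation 10.
FLOOR (seed g1-KontsevichZagierPeriods-17981, PROVED): `Cruxes.NeronTorsionSector.Translation.stub_assembly :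
Theses.TorsionLogs.NeronTorsionPrimitiveChain` — for a real curve `y² = f(x) = 4x³ − g₂x − g₃` over `ℚ̄ ∩ ℝ`,
`e₁ > 0` its largest root, and ONE real `N`-torsion point `S` of the identity component (`N·u_S = a·ω₁`,
`ρ = 1/2 − a/N = p/q`), an explicit chain of KZ moves realises `q²•[rI(S)] + p²•[rP] − c•[rB] ∈ KZ.relations`
(`rI(S)` = Néron triangle `∬_{e₁<x′<x<x_S} x′dx′dx/(√f√f)`, `rP` = first × second kind quadrant, `rB` = `dt/t` on `(1,B)`).

THE ONE MOVE of this rung (F1, hypothesis generalised — the BASE POINT of the torsion translation): in the floor the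
translation by the torsion class is read off between the 2-torsion corner `T₁ = (e₁, 0)` and `S` (the Néron
triangle starts at the corner `e₁`; value `λ̃(u_S) − λ̃(ω₁/2) − (quadratic)`).  Here the base point becomes a FREE real
point `P = (x_P, −√f(x_P))`, `x_P ≥ e₁`, of the identity component — no torsion or order hypothesis on `P`.  With
`T := S + T₁ = (x_T, −√f(x_T))`, `(x_T − e₁)(x_S − e₁) = 3e₁² − g₂/4` (the real `q`-torsion point `u_T = (p/q)·ω₁`),
and `R := P + T`, `x_R = (√f(x_P) − √f(x_T))²/(4(x_P − x_T)²) − x_P − x_T` (chord formula), the TIED COSET ELEMENT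

  `X(P) = q²•[rI(R)] − q²•[rI(P)] + (pq)•[rU(P)] + (p² − pq)•[rP] − c•[rB]`,
  `rU(P) = [(x_P,∞) × (e₁,∞), dx/√f(x) · (g₂x′+2g₃)dx′/(2x′²√f(x′))]` (value `η₁·u_P`: the η-CARRIER AT THE FREE POINT),

is a relation of the KZ move calculus whenever its value is `c·log B` (`NeronTorsionCoset`; members indexed by the
base abscissa `x_P ∈ [e₁, ∞)`).  THE BOUNDARY MEMBER `x_P = e₁` IS THE FLOOR: `P = T₁`, `R = S`
(`base_translate_eq`), `rI(P)` has EMPTY domain and `rU(P)` has the domain and integrand of `rP`, so that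
`X(T₁) ≡ q²•[rI(S)] + p²•[rP] − c•[rB]` modulo a null representation and a congruent pair (`base_of_floor`, which
CONSUMES `stub_assembly`; F3 file `Lines/NeronTorsionCoset_special.lean`).

VALUE (why the tie is met with `B` real algebraic — checked numerically in the filing folder, `compute/coset_check.py` and
`compute/divpoly_check.py`, pure-python tanh–sinh quadrature, curve `(g₂,g₃) = (28,−24)`, `e₁ = 2`, torsion data
`(N,a) ∈ {(6,1),(5,1),(4,1),(5,2),(7,2)}` i.e. `q ∈ {3,10,4,10,14}`, base points `x_P ∈ {2.5, 3.3, 6, 15}`):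
  `q²·rR.value − q²·rI.value + pq·rU.value + (p² − pq)·rP.value = log |ψ_q(P+T) / ψ_q(P)|`      (agreement ≤ 2·10⁻¹²),
`ψ_q` the `q`-division polynomial of `Y² = x³ − (g₂/4)x − g₃/4` evaluated at the real algebraic points `P+T`, `P`.
Mechanism of the value: with `λ̃(u) = −log|σ(u)| + η₁u²/(2ω₁)` (the archimedean Néron function, Silverman ATAEC VI
Thm 3.2) and the landed dictionary `I(X(u)) = λ̃(u) − λ̃(ω₁/2) − (η₁/(2ω₁))(ω₁/2 − u)²` (`TorsionLogs.RealSigma`),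
the left side is `q²·(λ̃(u_P + u_T) − λ̃(u_P))` (the quadratic corrections produce exactly the η-carrier terms
`pq·η₁u_P + (p² − pq)·η₁ω₁/2` because `u_T = (p/q)ω₁`), and the multiplication formula
`λ([m]P) = m²λ(P) + log|ψ_m(P)| − ((m²−1)/12)·log|Δ|` (ATAEC VI Ex. 6.4(e)) at `m = q` for the two points `P` and
`P + T`, which have THE SAME multiple `[q](P+T) = [q]P`, gives `q²(λ(P+T) − λ(P)) = log|ψ_q(P+T)/ψ_q(P)|`.
So the value of `X(P)` is the logarithm of a real algebraic number although `I(x_P)`, `I(x_R)` and `η₁u_P` are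
separately transcendental for non-torsion `P`: TORSION-TRANSLATION INVARIANCE OF THE NÉRON FUNCTION up to `log ℚ̄`
— the rung is non-vacuous exactly where one-point identities stop.  (Relation to line `NeronDistribution`, gen 5:
at the VALUE level `X(P)` is `−¼·(E_q(P+T) − E_q(P))` for its `[q]`-distribution elements plus one first-kind sheet
relation; as MOVE CHAINS the two lines differ — here only the 1-to-1 translation `τ_T` of the floor's calculus is
used, never the `q`-to-1 multiplication map and its sheet decomposition; the coset rung is the smallest step above
the floor and is implied by, but does not imply, the distribution rung.)

WHY THE FLOOR'S PROOF STOPS HERE (`Theorems/TorsionLogsNeronTorsionSectorAssemblyMain.lean`): the floor closes the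
finite translation grid `x_k = X(kω₁/n)` — the ORBIT OF THE 2-TORSION CORNER — using (i) the corner slice at
`x_m = e₁` (`asmS2_corner`, needs `f e₁ = 0`), (ii) the fold at the corner (`asmX_fold`) and (iii) the reflection
symmetry `qv j = qv (n − j)` of the grid values (`chain_to_logClass … hper hsym`, `stub_periodSymmetry`).  The coset
`{u_P + k·u_T}` of a FREE point has NO reflection symmetry and NO corner: the column at `x_P` is a REGULAR column,
whose boundary class is the first × second kind rectangle `(x_P,∞) × (e₁,∞)` of TRANSCENDENTAL value `η₁u_P` — it can
neither be folded away (floor) nor identified with an algebraic residue (line `NeronTorsionTwoPoint`, second point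
torsion): it must be CARRIED, as the term `(pq)•[rU(P)]`.  NEW IDEA: telescoping along the ASYMMETRIC orbit
`P, P+T, …, P+(q−1)T`, closed by periodicity alone (`q·u_T = p·ω₁`), the regular boundary column kept as an
η-carrier (stub `stub_cosetChain`); equivalently, the Miller loop of `G_T` read as KZ moves.

Composition: `NeronTorsionCoset_of : CosetChain → NeronTorsionCoset` (PROVED here: boundary member from the floor BY
NAME, interior members from the primitive stub by soundness + the landed interval-log calculus), the closure lemma
`closure_cosetTied_le_relations`, and the hypothesis-free `TorsionSectorComplete_of : TorsionSectorComplete` (the crux BY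
NAME, `suffices key : CosetChain → CosetSectorComplete → TorsionSectorComplete from key stub_cosetChain
stub_cosetSectorComplete`; `CosetSectorComplete` is the declared conjecture-grade RESIDUAL, weaker than the crux).  ON-PATH (F4): `neronTorsionCoset_of_kontsevichZagierPeriods` (kernel form of the summit applied to
the tied element; no sorry; verbatim in `Lines/NeronTorsionCoset_onpath.lean`).
-/

namespace Summit.KontsevichZagierPeriods.KontsevichZagierPeriods.Cruxes.TorsionSectorComplete.NeronTorsionCoset

open Set MeasureTheory
open Literature.NumberTheory.Transcendental
open Summit.KontsevichZagierPeriods.KontsevichZagierPeriods.Theses.TorsionLogs (TorsionSectorComplete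
  NeronTorsionPrimitiveChain)
open Summit.KontsevichZagierPeriods.KontsevichZagierPeriods.Cruxes.NeronTorsionSector.Translation (stub_assembly
  logRep_value isAlgebraic_of_logRep)
open Summit.KontsevichZagierPeriods.HyperbolicBloch.OffTetraSectorKernel (interval_log_relation_mem_relations)

-- `Summit.KontsevichZagierPeriods.KontsevichZagierPeriods.…` is the tree's mandated layout (single-conjunct summit).
set_option linter.dupNamespace false
set_option linter.unusedVariables false

/-- **THE RUNG `NeronTorsionCoset`** (tied form; members indexed by the base abscissa `x_P ∈ [e₁, ∞)`).
Data: the floor's torsion datum `S = (x_S, y_S)` verbatim (order `N`, `N·u_S = a·ω₁`, `ρ = (N−2a)/(2N) = p/q`), its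
companion `T = S + (e₁,0)` through the abscissa `x_T` (`(x_T − e₁)(x_S − e₁) = 3e₁² − g₂/4`), a FREE base point
`P = (x_P, −√f(x_P))`, `e₁ ≤ x_P ≠ x_T`, and the chord abscissa `x_R > e₁` of `R = P + T` (both ordinates `−√f`).
CLAIM: for every log carrier `rB = [1<t<B, dt/t]` and `c ∈ ℤ` with
`q²·rR.value − q²·rI.value + pq·rU.value + (p² − pq)·rP.value = c·rB.value`,
`q²•[rR] − q²•[rI] + (pq)•[rU] + (p² − pq)•[rP] − c•[rB] ∈ KZ.relations`.
Boundary member `x_P = e₁` = the floor (`NeronTorsionCosetBase`, `base_of_floor`).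
[cite: KontsevichZagier2001, §1.2] [cite: SilvermanATAEC1994, VI Thm 3.2, Cor. 3.3, Ex. 6.4(e)] [cite: Lang1983, Ch. 13 Thm 1.1] -/
def NeronTorsionCoset : Prop :=
  ∀ (g₂ g₃ e₁ xS yS xT xP xR : ℝ) (N a p q : ℕ) (f : ℝ → ℝ),
    (∀ x, f x = 4 * x ^ 3 - g₂ * x - g₃) → g₂ ^ 3 - 27 * g₃ ^ 2 ≠ 0 → f e₁ = 0 → 0 < e₁ →
    (∀ x, e₁ < x → 0 < f x) → e₁ < xS → yS ^ 2 = f xS → 3 ≤ N → 0 < a → 2 * a < N →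
    (∀ hns : (⟨0, 0, 0, -g₂ / 4, -g₃ / 4⟩ : WeierstrassCurve ℝ).toAffine.Nonsingular xS (yS / 2),
      addOrderOf (WeierstrassCurve.Affine.Point.some xS (yS / 2) hns) = N) →
    (N : ℝ) * (∫ x in Set.Ioi xS, (Real.sqrt (f x))⁻¹) = a * (2 * ∫ x in Set.Ioi e₁, (Real.sqrt (f x))⁻¹) →
    Nat.Coprime p q → (q : ℤ) * ((N : ℤ) - 2 * (a : ℤ)) = (p : ℤ) * (2 * (N : ℤ)) →
    e₁ < xT → (xT - e₁) * (xS - e₁) = 3 * e₁ ^ 2 - g₂ / 4 →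
    e₁ ≤ xP → xP ≠ xT →
    xR = (Real.sqrt (f xP) - Real.sqrt (f xT)) ^ 2 / (4 * (xP - xT) ^ 2) - xP - xT → e₁ < xR →
    ∀ (rR rI rU rP : KZ.IntegralRep 2),
    rR.domain = {z | e₁ < z 1 ∧ z 1 < z 0 ∧ z 0 < xR} →
    Set.EqOn rR.integrand (fun z => z 1 / (Real.sqrt (f (z 1)) * Real.sqrt (f (z 0)))) rR.domain →
    rI.domain = {z | e₁ < z 1 ∧ z 1 < z 0 ∧ z 0 < xP} →
    Set.EqOn rI.integrand (fun z => z 1 / (Real.sqrt (f (z 1)) * Real.sqrt (f (z 0)))) rI.domain →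
    rU.domain = {z | xP < z 0 ∧ e₁ < z 1} →
    Set.EqOn rU.integrand
      (fun z => (Real.sqrt (f (z 0)))⁻¹ * ((g₂ * z 1 + 2 * g₃) / (2 * (z 1) ^ 2 * Real.sqrt (f (z 1))))) rU.domain →
    rP.domain = {z | e₁ < z 0 ∧ e₁ < z 1} →
    Set.EqOn rP.integrand
      (fun z => (Real.sqrt (f (z 0)))⁻¹ * ((g₂ * z 1 + 2 * g₃) / (2 * (z 1) ^ 2 * Real.sqrt (f (z 1))))) rP.domain →
    ∀ (c : ℤ) (B : ℝ) (rB : KZ.IntegralRep 1), 1 < B → rB.domain = {t | 1 < t 0 ∧ t 0 < B} →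
    Set.EqOn rB.integrand (fun t => (t 0)⁻¹) rB.domain →
    (q : ℝ) ^ 2 * rR.value - (q : ℝ) ^ 2 * rI.value + (p : ℝ) * q * rU.value + ((p : ℝ) ^ 2 - p * q) * rP.value = c * rB.value →
    ((q : ℤ) ^ 2) • KZ.of rR - ((q : ℤ) ^ 2) • KZ.of rI + ((p : ℤ) * q) • KZ.of rU +
        ((p : ℤ) ^ 2 - p * q) • KZ.of rP - c • KZ.of rB ∈ KZ.relations

/-- **STUB statement `CosetChain`** (primitive form, interior members `e₁ < x_P`, NO value hypothesis): an explicit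
chain of KZ moves realises `q²•[rR] − q²•[rI] + (pq)•[rU] + (p² − pq)•[rP] − c•[rB] ∈ relations` for SOME `c ∈ ℤ` and
SOME log carrier on `(1, B)`, `B > 1` real algebraic — the floor's conclusion shape, one base point up.
[cite: KontsevichZagier2001, §1.2] -/
def CosetChain : Prop :=
  ∀ (g₂ g₃ e₁ xS yS xT xP xR : ℝ) (N a p q : ℕ) (f : ℝ → ℝ),
    (∀ x, f x = 4 * x ^ 3 - g₂ * x - g₃) → g₂ ^ 3 - 27 * g₃ ^ 2 ≠ 0 → f e₁ = 0 → 0 < e₁ →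
    (∀ x, e₁ < x → 0 < f x) → e₁ < xS → yS ^ 2 = f xS → 3 ≤ N → 0 < a → 2 * a < N →
    (∀ hns : (⟨0, 0, 0, -g₂ / 4, -g₃ / 4⟩ : WeierstrassCurve ℝ).toAffine.Nonsingular xS (yS / 2),
      addOrderOf (WeierstrassCurve.Affine.Point.some xS (yS / 2) hns) = N) →
    (N : ℝ) * (∫ x in Set.Ioi xS, (Real.sqrt (f x))⁻¹) = a * (2 * ∫ x in Set.Ioi e₁, (Real.sqrt (f x))⁻¹) →
    Nat.Coprime p q → (q : ℤ) * ((N : ℤ) - 2 * (a : ℤ)) = (p : ℤ) * (2 * (N : ℤ)) →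
    e₁ < xT → (xT - e₁) * (xS - e₁) = 3 * e₁ ^ 2 - g₂ / 4 →
    e₁ < xP → xP ≠ xT →
    xR = (Real.sqrt (f xP) - Real.sqrt (f xT)) ^ 2 / (4 * (xP - xT) ^ 2) - xP - xT → e₁ < xR →
    ∀ (rR rI rU rP : KZ.IntegralRep 2),
    rR.domain = {z | e₁ < z 1 ∧ z 1 < z 0 ∧ z 0 < xR} →
    Set.EqOn rR.integrand (fun z => z 1 / (Real.sqrt (f (z 1)) * Real.sqrt (f (z 0)))) rR.domain →
    rI.domain = {z | e₁ < z 1 ∧ z 1 < z 0 ∧ z 0 < xP} →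
    Set.EqOn rI.integrand (fun z => z 1 / (Real.sqrt (f (z 1)) * Real.sqrt (f (z 0)))) rI.domain →
    rU.domain = {z | xP < z 0 ∧ e₁ < z 1} →
    Set.EqOn rU.integrand
      (fun z => (Real.sqrt (f (z 0)))⁻¹ * ((g₂ * z 1 + 2 * g₃) / (2 * (z 1) ^ 2 * Real.sqrt (f (z 1))))) rU.domain →
    rP.domain = {z | e₁ < z 0 ∧ e₁ < z 1} →
    Set.EqOn rP.integrand
      (fun z => (Real.sqrt (f (z 0)))⁻¹ * ((g₂ * z 1 + 2 * g₃) / (2 * (z 1) ^ 2 * Real.sqrt (f (z 1))))) rP.domain →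
    ∃ (c : ℤ) (B : ℝ) (rB : KZ.IntegralRep 1), 1 < B ∧ IsAlgebraic ℚ B ∧
      rB.domain = {t | 1 < t 0 ∧ t 0 < B} ∧ Set.EqOn rB.integrand (fun t => (t 0)⁻¹) rB.domain ∧
      ((q : ℤ) ^ 2) • KZ.of rR - ((q : ℤ) ^ 2) • KZ.of rI + ((p : ℤ) * q) • KZ.of rU +
        ((p : ℤ) ^ 2 - p * q) • KZ.of rP - c • KZ.of rB ∈ KZ.relations

/-- The BOUNDARY MEMBER `x_P = e₁` of the rung, spelled out (the rung's text with `xP := e₁`; `base_of_rung` is the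
literal instantiation): `P = T₁ = (e₁,0)`, `R = S`, `rI` on the EMPTY triangle, `rU` on the quadrant of `rP`.
Delivered by the floor (`base_of_floor`). [cite: KontsevichZagier2001, §1.2] -/
def NeronTorsionCosetBase : Prop :=
  ∀ (g₂ g₃ e₁ xS yS xT xR : ℝ) (N a p q : ℕ) (f : ℝ → ℝ),
    (∀ x, f x = 4 * x ^ 3 - g₂ * x - g₃) → g₂ ^ 3 - 27 * g₃ ^ 2 ≠ 0 → f e₁ = 0 → 0 < e₁ →
    (∀ x, e₁ < x → 0 < f x) → e₁ < xS → yS ^ 2 = f xS → 3 ≤ N → 0 < a → 2 * a < N →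
    (∀ hns : (⟨0, 0, 0, -g₂ / 4, -g₃ / 4⟩ : WeierstrassCurve ℝ).toAffine.Nonsingular xS (yS / 2),
      addOrderOf (WeierstrassCurve.Affine.Point.some xS (yS / 2) hns) = N) →
    (N : ℝ) * (∫ x in Set.Ioi xS, (Real.sqrt (f x))⁻¹) = a * (2 * ∫ x in Set.Ioi e₁, (Real.sqrt (f x))⁻¹) →
    Nat.Coprime p q → (q : ℤ) * ((N : ℤ) - 2 * (a : ℤ)) = (p : ℤ) * (2 * (N : ℤ)) →
    e₁ < xT → (xT - e₁) * (xS - e₁) = 3 * e₁ ^ 2 - g₂ / 4 →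
    e₁ ≤ e₁ → e₁ ≠ xT →
    xR = (Real.sqrt (f e₁) - Real.sqrt (f xT)) ^ 2 / (4 * (e₁ - xT) ^ 2) - e₁ - xT → e₁ < xR →
    ∀ (rR rI rU rP : KZ.IntegralRep 2),
    rR.domain = {z | e₁ < z 1 ∧ z 1 < z 0 ∧ z 0 < xR} →
    Set.EqOn rR.integrand (fun z => z 1 / (Real.sqrt (f (z 1)) * Real.sqrt (f (z 0)))) rR.domain →
    rI.domain = {z | e₁ < z 1 ∧ z 1 < z 0 ∧ z 0 < e₁} →
    Set.EqOn rI.integrand (fun z => z 1 / (Real.sqrt (f (z 1)) * Real.sqrt (f (z 0)))) rI.domain →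
    rU.domain = {z | e₁ < z 0 ∧ e₁ < z 1} →
    Set.EqOn rU.integrand
      (fun z => (Real.sqrt (f (z 0)))⁻¹ * ((g₂ * z 1 + 2 * g₃) / (2 * (z 1) ^ 2 * Real.sqrt (f (z 1))))) rU.domain →
    rP.domain = {z | e₁ < z 0 ∧ e₁ < z 1} →
    Set.EqOn rP.integrand
      (fun z => (Real.sqrt (f (z 0)))⁻¹ * ((g₂ * z 1 + 2 * g₃) / (2 * (z 1) ^ 2 * Real.sqrt (f (z 1))))) rP.domain →
    ∀ (c : ℤ) (B : ℝ) (rB : KZ.IntegralRep 1), 1 < B → rB.domain = {t | 1 < t 0 ∧ t 0 < B} →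
    Set.EqOn rB.integrand (fun t => (t 0)⁻¹) rB.domain →
    (q : ℝ) ^ 2 * rR.value - (q : ℝ) ^ 2 * rI.value + (p : ℝ) * q * rU.value + ((p : ℝ) ^ 2 - p * q) * rP.value = c * rB.value →
    ((q : ℤ) ^ 2) • KZ.of rR - ((q : ℤ) ^ 2) • KZ.of rI + ((p : ℤ) * q) • KZ.of rU +
        ((p : ℤ) ^ 2 - p * q) • KZ.of rP - c • KZ.of rB ∈ KZ.relations

/-- The crux's own sector: the tied Néron–torsion elements (the set inside `TorsionSectorComplete`, verbatim).
[cite: KontsevichZagier2001, §1.2] -/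
def TorsionTied : Set KZ.FormalRep :=
  {d : KZ.FormalRep | ∃ (g₂ g₃ e₁ xP yP α : ℝ) (N a : ℕ) (M k m : ℤ) (f : ℝ → ℝ) (rI rP : KZ.IntegralRep 2) (rL : KZ.IntegralRep 1), (∀ x, f x = 4 * x ^ 3 - g₂ * x - g₃) ∧ g₂ ^ 3 - 27 * g₃ ^ 2 ≠ 0 ∧ f e₁ = 0 ∧ 0 < e₁ ∧ (∀ x, e₁ < x → 0 < f x) ∧ e₁ < xP ∧ yP ^ 2 = f xP ∧ 3 ≤ N ∧ 0 < a ∧ 2 * a < N ∧ 4 * (N : ℤ) ^ 2 * k = M * ((N : ℤ) - 2 * (a : ℤ)) ^ 2 ∧ (∀ hns : (⟨0, 0, 0, -g₂ / 4, -g₃ / 4⟩ : WeierstrassCurve ℝ).toAffine.Nonsingular xP (yP / 2), addOrderOf (WeierstrassCurve.Affine.Point.some xP (yP / 2) hns) = N) ∧ (N : ℝ) * (∫ x in Set.Ioi xP, (Real.sqrt (f x))⁻¹) = a * (2 * ∫ x in Set.Ioi e₁, (Real.sqrt (f x))⁻¹) ∧ 1 < α ∧ rI.domain = {z | e₁ <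 z 1 ∧ z 1 < z 0 ∧ z 0 < xP} ∧ Set.EqOn rI.integrand (fun z => z 1 / (Real.sqrt (f (z 1)) * Real.sqrt (f (z 0)))) rI.domain ∧ rP.domain = {z | e₁ < z 0 ∧ e₁ < z 1} ∧ Set.EqOn rP.integrand (fun z => (Real.sqrt (f (z 0)))⁻¹ * ((g₂ * z 1 + 2 * g₃) / (2 * (z 1) ^ 2 * Real.sqrt (f (z 1))))) rP.domain ∧ rL.domain = {t | 1 < t 0 ∧ t 0 < α} ∧ Set.EqOn rL.integrand (fun t => (t 0)⁻¹) rL.domain ∧ (M : ℝ) * rI.value + k * rP.value = m * rL.value ∧ d = M • KZ.of rI + k • KZ.of rP - m • KZ.of rL}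

/-- Sanity: the crux is completeness modulo `relations ⊔ closure TorsionTied` (definitional). [folklore] -/
theorem torsionSectorComplete_iff : TorsionSectorComplete ↔
    ∀ ⦃n m : ℕ⦄ (r : KZ.IntegralRep n) (r' : KZ.IntegralRep m), r.IsRational → r'.IsRational →
      r.value = r'.value → KZ.of r - KZ.of r' ∈ KZ.relations ⊔ AddSubgroup.closure TorsionTied :=
  Iff.rfl

/-- The tied COSET elements (the rung's data and tie), as a subset of `FormalRep`. [cite: KontsevichZagier2001, §1.2] -/
def CosetTied : Set KZ.FormalRep :=
  {d : KZ.FormalRep | ∃ (g₂ g₃ e₁ xS yS xT xP xR : ℝ) (N a p q : ℕ) (f : ℝ → ℝ) (rR rI rU rP : KZ.IntegralRep 2)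
      (c : ℤ) (B : ℝ) (rB : KZ.IntegralRep 1),
    (∀ x, f x = 4 * x ^ 3 - g₂ * x - g₃) ∧ g₂ ^ 3 - 27 * g₃ ^ 2 ≠ 0 ∧ f e₁ = 0 ∧ 0 < e₁ ∧
    (∀ x, e₁ < x → 0 < f x) ∧ e₁ < xS ∧ yS ^ 2 = f xS ∧ 3 ≤ N ∧ 0 < a ∧ 2 * a < N ∧
    (∀ hns : (⟨0, 0, 0, -g₂ / 4, -g₃ / 4⟩ : WeierstrassCurve ℝ).toAffine.Nonsingular xS (yS / 2),
      addOrderOf (WeierstrassCurve.Affine.Point.some xS (yS / 2) hns) = N) ∧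
    (N : ℝ) * (∫ x in Set.Ioi xS, (Real.sqrt (f x))⁻¹) = a * (2 * ∫ x in Set.Ioi e₁, (Real.sqrt (f x))⁻¹) ∧
    Nat.Coprime p q ∧ (q : ℤ) * ((N : ℤ) - 2 * (a : ℤ)) = (p : ℤ) * (2 * (N : ℤ)) ∧
    e₁ < xT ∧ (xT - e₁) * (xS - e₁) = 3 * e₁ ^ 2 - g₂ / 4 ∧ e₁ ≤ xP ∧ xP ≠ xT ∧
    xR = (Real.sqrt (f xP) - Real.sqrt (f xT)) ^ 2 / (4 * (xP - xT) ^ 2) - xP - xT ∧ e₁ < xR ∧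
    rR.domain = {z | e₁ < z 1 ∧ z 1 < z 0 ∧ z 0 < xR} ∧
    Set.EqOn rR.integrand (fun z => z 1 / (Real.sqrt (f (z 1)) * Real.sqrt (f (z 0)))) rR.domain ∧
    rI.domain = {z | e₁ < z 1 ∧ z 1 < z 0 ∧ z 0 < xP} ∧
    Set.EqOn rI.integrand (fun z => z 1 / (Real.sqrt (f (z 1)) * Real.sqrt (f (z 0)))) rI.domain ∧
    rU.domain = {z | xP < z 0 ∧ e₁ < z 1} ∧
    Set.EqOn rU.integrand
      (fun z => (Real.sqrt (f (z 0)))⁻¹ * ((g₂ * z 1 + 2 * g₃) / (2 * (z 1) ^ 2 * Real.sqrt (f (z 1))))) rU.domain ∧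
    rP.domain = {z | e₁ < z 0 ∧ e₁ < z 1} ∧
    Set.EqOn rP.integrand
      (fun z => (Real.sqrt (f (z 0)))⁻¹ * ((g₂ * z 1 + 2 * g₃) / (2 * (z 1) ^ 2 * Real.sqrt (f (z 1))))) rP.domain ∧
    1 < B ∧ rB.domain = {t | 1 < t 0 ∧ t 0 < B} ∧ Set.EqOn rB.integrand (fun t => (t 0)⁻¹) rB.domain ∧
    (q : ℝ) ^ 2 * rR.value - (q : ℝ) ^ 2 * rI.value + (p : ℝ) * q * rU.value + ((p : ℝ) ^ 2 - p * q) * rP.value = c * rB.value ∧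
    d = ((q : ℤ) ^ 2) • KZ.of rR - ((q : ℤ) ^ 2) • KZ.of rI + ((p : ℤ) * q) • KZ.of rU +
        ((p : ℤ) ^ 2 - p * q) • KZ.of rP - c • KZ.of rB}

/-- **RESIDUAL `CosetSectorComplete`** (stub 2, conjecture-grade, declared residual): Conjecture 1 for rational pairs
MODULO the torsion sector ENLARGED by the tied coset elements, `(relations ⊔ closure TorsionTied) ⊔ closure CosetTied`.
Weaker than the crux (monotonicity of `⊔`: `cosetSectorComplete_of_torsionSectorComplete`).  Kill path: a rational
pair separated from the enlarged sector (genus-2 regulator, CM value, complex points). [cite: KontsevichZagier2001, §1.2] -/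
def CosetSectorComplete : Prop :=
  ∀ ⦃n m : ℕ⦄ (r : KZ.IntegralRep n) (r' : KZ.IntegralRep m), r.IsRational → r'.IsRational →
    r.value = r'.value →
    KZ.of r - KZ.of r' ∈ (KZ.relations ⊔ AddSubgroup.closure TorsionTied) ⊔ AddSubgroup.closure CosetTied


/-! ### Registered stubs -/

/-- **Stub 1 (XL — the mechanism, load-bearing): the coset chain.**  Proof plan (torsion-coset telescoping): put the
`q` points `P_k = P + kT`, `k = 0,…,q−1` (abscissae real algebraic by the chord recursion from `x_P`, `x_T`; the
orbit CLOSES because `q·u_T = p·ω₁ ∈ Λ`) on the floor's translation calculus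
(`Theorems/TorsionLogsNeronTorsionSectorStubTranslationCalculus.lean`: translation `τ_T` by the FIXED torsion
point, regular second-kind form `h = (g₂x + 2g₃)dx/(4x²y)`, cocycle `h∘τ_T − h = dQ̃` with `Q̃` rational over
`ℚ(g₂,g₃,x_T,y_T)`; the dlog-unfolding files `StubDlogUnfold*`; Newton–Leibniz in the inner variable): translating
the strip between the columns `x_{P_k}`, `x_{P_{k+1}}` by `τ_T` and summing over the orbit telescopes the Néron
triangles to `[rI(R)] − [rI(P)]` plus boundary columns; the boundary column at the REGULAR base abscissa `x_P` is
the first × second kind rectangle `(x_P,∞) × (e₁,∞)` = `rU(P)` (KEPT as a carrier — coefficient `pq` = `q` copies ×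
the `p` full periods crossed by the orbit), the complete columns contribute `(p² − pq)•[rP]`, and the dlog terms
are log carriers with real algebraic endpoints, merged into one `[1<t<B, dt/t]` by the landed
`interval_log_relation_mem_relations` / `exists_carrier_of_logFamily`.  Why it might fail AS TYPED: the integer
elimination may only close up to a multiplier (`d•X(P) ∈ relations`, and saturation of `relations` is
Conjecture-1-strength); the floor's elimination closed with coefficients `(q², p²)` thanks to the reflection symmetry
of its grid (`stub_periodSymmetry`), which the coset lacks — the coefficient pattern `(q², −q², pq, p² − pq)` is the
numerically verified candidate.  Size XL.  [cite: KontsevichZagier2001, §1.2] [cite: SilvermanATAEC1994, VI Thm 3.2, Cor. 3.3, Ex. 6.4(e)] [cite: Lang1983, Ch. 13 Thm 1.1] -/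
theorem stub_cosetChain : CosetChain := by
  sorry

/-- **Stub 2 (residual, conjecture-grade; NOT a prover target — kill path only).** [cite: KontsevichZagier2001, §1.2] -/
theorem stub_cosetSectorComplete : CosetSectorComplete := by
  sorry


/-! ### Bookkeeping (no sorry): carriers, null and congruent representations, the boundary abscissa -/

/-- Interval-log calculus with two carriers: `c₀·log B₀ = c·log B` between logs of real algebraic numbers `> 1` gives
`c₀•[rB₀] − c•[rB] ∈ relations` (landed `interval_log_relation_mem_relations`). [cite: KontsevichZagier2001, §1.1] -/
theorem carrier_swap {c₀ c : ℤ} {B₀ B : ℝ} (rB₀ rB : KZ.IntegralRep 1)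
    (hB₀ : 1 < B₀) (hB : 1 < B) (hB₀alg : IsAlgebraic ℚ B₀) (hBalg : IsAlgebraic ℚ B)
    (hd₀ : rB₀.domain = {t | 1 < t 0 ∧ t 0 < B₀}) (hi₀ : Set.EqOn rB₀.integrand (fun t => (t 0)⁻¹) rB₀.domain)
    (hd : rB.domain = {t | 1 < t 0 ∧ t 0 < B}) (hi : Set.EqOn rB.integrand (fun t => (t 0)⁻¹) rB.domain)
    (hlog : (c₀ : ℝ) * Real.log B₀ - c * Real.log B = 0) :
    c₀ • KZ.of rB₀ - c • KZ.of rB ∈ KZ.relations := by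
  have hi₀1 : Set.EqOn rB₀.integrand (fun t : Fin 1 → ℝ => 1 / t 0) rB₀.domain := fun t ht => by
    simp only [hi₀ ht, one_div]
  have hi1 : Set.EqOn rB.integrand (fun t : Fin 1 → ℝ => 1 / t 0) rB.domain := fun t ht => by
    simp only [hi ht, one_div]
  have h := interval_log_relation_mem_relations 2 ![1, 1] ![B₀, B] ![c₀, -c] ![rB₀, rB]
    (fun i => by fin_cases i <;> simp)
    (fun i => by fin_cases i <;> simp [hB₀.le, hB.le])
    (fun i => by fin_cases i <;> exact isAlgebraic_one)
    (fun i => by fin_cases i <;> simp [hB₀alg, hBalg])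
    (fun i => by
      fin_cases i
      · exact ⟨hd₀, hi₀1⟩
      · exact ⟨hd, hi1⟩)
    (by
      simp only [Fin.sum_univ_two, Matrix.cons_val_zero, Matrix.cons_val_one, div_one, Int.cast_neg]
      linear_combination hlog)
  have e : ∑ i : Fin 2, (![c₀, -c] i : ℤ) • KZ.of (![rB₀, rB] i) = c₀ • KZ.of rB₀ - c • KZ.of rB := by
    simp only [Fin.sum_univ_two, Matrix.cons_val_zero, Matrix.cons_val_one, neg_smul]
    abel
  rw [e] at h
  exact h

/-- A Néron "triangle" `{e < z 1 < z 0 < e}` is EMPTY: its representation is a relation (null move) and has value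
`0`. [folklore] -/
theorem emptyTriangle (r : KZ.IntegralRep 2) {e : ℝ} (hd : r.domain = {z | e < z 1 ∧ z 1 < z 0 ∧ z 0 < e}) :
    KZ.of r ∈ KZ.relations ∧ r.value = 0 := by
  have hempty : r.domain = ∅ := by
    rw [hd]
    ext z
    simp only [Set.mem_setOf_eq, Set.mem_empty_iff_false, iff_false, not_and]
    intro h1 h2 h3
    linarith
  refine ⟨KZ.of_mem_relations_of_volume_eq_zero r (by rw [hempty, measure_empty]), ?_⟩
  show ∫ x in r.domain, r.integrand x = 0
  rw [hempty, Measure.restrict_empty, integral_zero_measure]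

/-- Two representations with the same domain whose integrands agree with one function on it: their difference is a
relation (integrand congruence) and their values agree. [folklore] -/
theorem congr_pair {n : ℕ} (r r' : KZ.IntegralRep n) {F : (Fin n → ℝ) → ℝ} (hd : r.domain = r'.domain)
    (hi : Set.EqOn r.integrand F r.domain) (hi' : Set.EqOn r'.integrand F r'.domain) :
    KZ.of r - KZ.of r' ∈ KZ.relations ∧ r.value = r'.value := by
  have hio : Set.EqOn r.integrand r'.integrand r.domain := fun z hz => by
    rw [hi hz, hi' (hd ▸ hz)]
  refine ⟨KZ.of_sub_of_mem_relations_of_eqOn hd.symm hio, ?_⟩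
  show ∫ x in r.domain, r.integrand x = ∫ x in r'.domain, r'.integrand x
  rw [setIntegral_congr_fun (KZ.IntegralRep.measurableSet_domain_holds r) hio, hd]

/-- The 2-torsion translation is an involution on abscissae: at the boundary member `x_P = e₁` the chord abscissa of
`R = T₁ + T` is `x_S` (uses `f e₁ = 0`, i.e. `g₃ = 4e₁³ − g₂e₁`). [folklore] -/
theorem base_translate_eq {g₂ g₃ e₁ xS xT xR : ℝ} {f : ℝ → ℝ} (hf : ∀ x, f x = 4 * x ^ 3 - g₂ * x - g₃)
    (he₁ : f e₁ = 0) (hTe : e₁ < xT) (hfT : 0 < f xT)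
    (hT : (xT - e₁) * (xS - e₁) = 3 * e₁ ^ 2 - g₂ / 4)
    (hR : xR = (Real.sqrt (f e₁) - Real.sqrt (f xT)) ^ 2 / (4 * (e₁ - xT) ^ 2) - e₁ - xT) : xR = xS := by
  have hs0 : Real.sqrt (f e₁) = 0 := by rw [he₁, Real.sqrt_zero]
  have hsT : Real.sqrt (f xT) ^ 2 = f xT := Real.sq_sqrt hfT.le
  have hne : xT - e₁ ≠ 0 := sub_ne_zero.mpr hTe.ne'
  have hne' : e₁ - xT ≠ 0 := sub_ne_zero.mpr hTe.ne
  have hg₃ : g₃ = 4 * e₁ ^ 3 - g₂ * e₁ := by have h := hf e₁; rw [he₁] at h; linarith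
  rw [hs0, zero_sub, neg_sq, hsT, hf xT, hg₃] at hR
  have hS : xS = e₁ + (3 * e₁ ^ 2 - g₂ / 4) / (xT - e₁) := by
    rw [← hT]; field_simp; ring
  rw [hR, hS]
  field_simp
  ring


/-! ### F3 — the boundary member is the floor -/

/-- `base_of_rung`: the boundary statement IS the rung's member `x_P = e₁` (literal instantiation). [folklore] -/
theorem base_of_rung (h : NeronTorsionCoset) : NeronTorsionCosetBase := by
  intro g₂ g₃ e₁ xS yS xT xR N a p q f hf hΔ he₁ he0 hpos hxS hyS hN ha ha2 hord htor hcop hpq hTe hT hP hPT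
    hR hRe rR rI rU rP hRd hRi hId hIi hUd hUi hPd hPi
  exact h g₂ g₃ e₁ xS yS xT e₁ xR N a p q f hf hΔ he₁ he0 hpos hxS hyS hN ha ha2 hord htor hcop hpq hTe hT hP hPT
    hR hRe rR rI rU rP hRd hRi hId hIi hUd hUi hPd hPi

/-- **`base_of_floor` (F3): the floor delivers the boundary member.**  At `x_P = e₁`: `x_R = x_S`
(`base_translate_eq`), `[rI] ∈ relations` with value `0` (empty triangle), `[rU] − [rP] ∈ relations` with equal
values (congruent pair); the floor `NeronTorsionPrimitiveChain` at the torsion datum `S` gives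
`q²•[rR] + p²•[rP] − c₀•[rB₀] ∈ relations` with `B₀` algebraic, soundness evaluates it, the tie identifies
`c·log B = c₀·log B₀`, and the interval-log calculus swaps the carriers.  No sorry; the floor is used BY NAME through
`cosetBase` below. [cite: KontsevichZagier2001, §1.2] -/
theorem base_of_floor (hfloor : NeronTorsionPrimitiveChain) : NeronTorsionCosetBase := by
  intro g₂ g₃ e₁ xS yS xT xR N a p q f hf hΔ he₁ he0 hpos hxS hyS hN ha ha2 hord htor hcop hpq hTe hT hP hPT
    hR hRe rR rI rU rP hRd hRi hId hIi hUd hUi hPd hPi c B rB hB hBd hBi hval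
  -- the boundary geometry: `x_R = x_S`
  have hfT : 0 < f xT := hpos xT hTe
  have hRS : xR = xS := base_translate_eq hf he₁ hTe hfT hT hR
  -- the null triangle and the congruent carrier pair
  obtain ⟨hImem, hIval⟩ := emptyTriangle rI hId
  obtain ⟨hUPmem, hUPval⟩ :=
    congr_pair rU rP (by rw [hUd, hPd]) hUi hPi
  -- the floor at the torsion datum `S`, with `rR` as its Néron triangle
  rw [hRS] at hRd
  obtain ⟨c₀, B₀, rB₀, hB₀, hB₀alg, hB₀d, hB₀i, hrel₀⟩ :=
    hfloor g₂ g₃ e₁ xS yS N a p q f hf hΔ he₁ he0 hpos hxS hyS hN ha ha2 hord htor hcop hpq rR rP hRd hRi hPd hPi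
  -- soundness on the floor's relation; the carriers evaluate to logarithms; `B` is algebraic (semialgebraic domain)
  have hBalg : IsAlgebraic ℚ B := isAlgebraic_of_logRep hB rB hBd
  have hB₀v : rB₀.value = Real.log B₀ := logRep_value hB₀.le rB₀ hB₀d hB₀i
  have hBv : rB.value = Real.log B := logRep_value hB.le rB hBd hBi
  have hev₀ := KZ.relations_le_ker_eval_holds hrel₀
  rw [AddMonoidHom.mem_ker] at hev₀
  simp only [map_sub, map_add, map_zsmul, KZ.eval_of, zsmul_eq_mul, Int.cast_pow, Int.cast_natCast, hB₀v] at hev₀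
  rw [hIval, hUPval, hBv] at hval
  have hlog : ((c₀ : ℤ) : ℝ) * Real.log B₀ - (c : ℝ) * Real.log B = 0 := by
    linear_combination hval - hev₀
  -- interval-log calculus: swap the floor's carrier for the given one
  have hswap := carrier_swap rB₀ rB hB₀ hB hB₀alg hBalg hB₀d hB₀i hBd hBi hlog
  -- assembly
  have e : ((q : ℤ) ^ 2) • KZ.of rR - ((q : ℤ) ^ 2) • KZ.of rI + ((p : ℤ) * q) • KZ.of rU +
        ((p : ℤ) ^ 2 - p * q) • KZ.of rP - c • KZ.of rB =
      (((q : ℤ) ^ 2) • KZ.of rR + ((p : ℤ) ^ 2) • KZ.of rP - c₀ • KZ.of rB₀) - ((q : ℤ) ^ 2) • KZ.of rI +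
        ((p : ℤ) * q) • (KZ.of rU - KZ.of rP) + (c₀ • KZ.of rB₀ - c • KZ.of rB) := by
    module
  rw [e]
  exact KZ.relations.add_mem (KZ.relations.add_mem (KZ.relations.sub_mem hrel₀ (KZ.relations.zsmul_mem hImem _))
    (KZ.relations.zsmul_mem hUPmem _)) hswap

/-- The boundary member, closed: floor BY NAME (`stub_assembly`, landed in
`Theorems/TorsionLogsNeronTorsionSectorAssemblyMain.lean`). No sorry. [cite: KontsevichZagier2001, §1.2] -/
theorem cosetBase : NeronTorsionCosetBase :=
  base_of_floor stub_assembly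


/-! ### The rung from the stubs; the crux by name -/

/-- **`NeronTorsionCoset_of`: the RUNG from stub 1** (the boundary member `x_P = e₁` is the floor, through
`cosetBase`; interior members: the primitive coset chain + soundness + the tie + the interval-log carrier swap).
[cite: KontsevichZagier2001, §1.2] -/
theorem NeronTorsionCoset_of (hchain : CosetChain) : NeronTorsionCoset := by
  intro g₂ g₃ e₁ xS yS xT xP xR N a p q f hf hΔ he₁ he0 hpos hxS hyS hN ha ha2 hord htor hcop hpq hTe hT hP hPT
    hR hRe rR rI rU rP hRd hRi hId hIi hUd hUi hPd hPi
  rcases hP.eq_or_lt with hPe | hPlt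
  · -- boundary member: `x_P = e₁`
    subst hPe
    exact cosetBase g₂ g₃ e₁ xS yS xT xR N a p q f hf hΔ he₁ he0 hpos hxS hyS hN ha ha2 hord htor hcop hpq hTe hT
      hP hPT hR hRe rR rI rU rP hRd hRi hId hIi hUd hUi hPd hPi
  · -- interior member: the coset chain
    intro c B rB hB hBd hBi hval
    obtain ⟨c₀, B₀, rB₀, hB₀, hB₀alg, hB₀d, hB₀i, hrel₀⟩ :=
      hchain g₂ g₃ e₁ xS yS xT xP xR N a p q f hf hΔ he₁ he0 hpos hxS hyS hN ha ha2 hord htor hcop hpq hTe hT hPlt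
        hPT hR hRe rR rI rU rP hRd hRi hId hIi hUd hUi hPd hPi
    have hBalg : IsAlgebraic ℚ B := isAlgebraic_of_logRep hB rB hBd
    have hB₀v : rB₀.value = Real.log B₀ := logRep_value hB₀.le rB₀ hB₀d hB₀i
    have hBv : rB.value = Real.log B := logRep_value hB.le rB hBd hBi
    have hev₀ := KZ.relations_le_ker_eval_holds hrel₀
    rw [AddMonoidHom.mem_ker] at hev₀
    simp only [map_sub, map_add, map_zsmul, KZ.eval_of, zsmul_eq_mul, Int.cast_pow, Int.cast_natCast,
      Int.cast_mul, Int.cast_sub, hB₀v] at hev₀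
    rw [hBv] at hval
    have hlog : ((c₀ : ℤ) : ℝ) * Real.log B₀ - (c : ℝ) * Real.log B = 0 := by
      linear_combination hval - hev₀
    have hswap := carrier_swap rB₀ rB hB₀ hB hB₀alg hBalg hB₀d hB₀i hBd hBi hlog
    have e : ((q : ℤ) ^ 2) • KZ.of rR - ((q : ℤ) ^ 2) • KZ.of rI + ((p : ℤ) * q) • KZ.of rU +
          ((p : ℤ) ^ 2 - p * q) • KZ.of rP - c • KZ.of rB =
        (((q : ℤ) ^ 2) • KZ.of rR - ((q : ℤ) ^ 2) • KZ.of rI + ((p : ℤ) * q) • KZ.of rU +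
          ((p : ℤ) ^ 2 - p * q) • KZ.of rP - c₀ • KZ.of rB₀) + (c₀ • KZ.of rB₀ - c • KZ.of rB) := by
      abel
    rw [e]
    exact KZ.relations.add_mem hrel₀ hswap

/-- Every tied coset element is a relation, given the rung. [cite: KontsevichZagier2001, §1.2] -/
theorem cosetTied_subset_relations (h : NeronTorsionCoset) : CosetTied ⊆ (KZ.relations : Set KZ.FormalRep) := by
  rintro d ⟨g₂, g₃, e₁, xS, yS, xT, xP, xR, N, a, p, q, f, rR, rI, rU, rP, c, B, rB, hf, hΔ, he₁, he0, hpos, hxS, hyS,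
    hN, ha, ha2, hord, htor, hcop, hpq, hTe, hT, hP, hPT, hR, hRe, hRd, hRi, hId, hIi, hUd, hUi, hPd, hPi, hB, hBd,
    hBi, hval, rfl⟩
  exact h g₂ g₃ e₁ xS yS xT xP xR N a p q f hf hΔ he₁ he0 hpos hxS hyS hN ha ha2 hord htor hcop hpq hTe hT hP hPT hR
    hRe rR rI rU rP hRd hRi hId hIi hUd hUi hPd hPi c B rB hB hBd hBi hval

/-- The closure of the tied coset elements lies in `relations`, given the rung. [folklore] -/
theorem closure_cosetTied_le_relations (h : NeronTorsionCoset) : AddSubgroup.closure CosetTied ≤ KZ.relations :=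
  (AddSubgroup.closure_le _).mpr (cosetTied_subset_relations h)

/-- The residual is WEAKER than the crux (monotonicity of `⊔`). [folklore] -/
theorem cosetSectorComplete_of_torsionSectorComplete (h : TorsionSectorComplete) : CosetSectorComplete :=
  fun _ _ r r' hr hr' hv => AddSubgroup.mem_sup_left (h r r' hr hr' hv)

/-- **The crux BY NAME from the two stubs** (closed term; `sorry` only through `stub_cosetChain`,
`stub_cosetSectorComplete`): the rung (from stub 1, boundary member = the floor) folds the enlarged sector back into
`relations ⊔ closure TorsionTied`; the residual supplies completeness modulo the enlarged sector.
[cite: KontsevichZagier2001, §1.2] -/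
theorem TorsionSectorComplete_of : TorsionSectorComplete := by
  suffices key : CosetChain → CosetSectorComplete → TorsionSectorComplete from
    key stub_cosetChain stub_cosetSectorComplete
  intro h₁ h₂
  have hle : (KZ.relations ⊔ AddSubgroup.closure TorsionTied) ⊔ AddSubgroup.closure CosetTied ≤
      KZ.relations ⊔ AddSubgroup.closure TorsionTied :=
    sup_le le_rfl ((closure_cosetTied_le_relations (NeronTorsionCoset_of h₁)).trans le_sup_left)
  intro n m r r' hr hr' hv
  exact hle (h₂ r r' hr hr' hv)

/-! ### F4 — on path: the summit implies the rung (verbatim in `Lines/NeronTorsionCoset_onpath.lean`) -/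

/-- **ON PATH.** `KontsevichZagierPeriods → NeronTorsionCoset`: the kernel form of the summit
(`kzKernelConjecture_iff_isRational`) applied to the tied element, whose evaluation vanishes by the value hypothesis
and soundness of `eval`.  Uniform in the base point; no sorry. [cite: KontsevichZagier2001, §1.2] -/
@[aesop safe apply]
theorem neronTorsionCoset_of_kontsevichZagierPeriods (h : _root_.KontsevichZagierPeriods) : NeronTorsionCoset := by
  have hK : KZKernelConjecture := kzKernelConjecture_iff_isRational.mpr (KontsevichZagierPeriods_iff.mp h)
  intro g₂ g₃ e₁ xS yS xT xP xR N a p q f hf hΔ he₁ he0 hpos hxS hyS hN ha ha2 hord htor hcop hpq hTe hT hP hPT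
    hR hRe rR rI rU rP hRd hRi hId hIi hUd hUi hPd hPi c B rB hB hBd hBi hval
  refine hK _ ?_
  simp only [map_sub, map_add, map_zsmul, KZ.eval_of, zsmul_eq_mul, Int.cast_pow, Int.cast_natCast, Int.cast_mul,
    Int.cast_sub]
  linear_combination hval

end Summit.KontsevichZagierPeriods.KontsevichZagierPeriods.Cruxes.TorsionSectorComplete.NeronTorsionCoset
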